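import Summits.FinalStateConjecture.FinalStateConjecture.Theses.PhotonSphereChannels
import Summits.FinalStateConjecture.FinalStateConjecture.Theorems.PhotonSphereChannelsExteriorEnergyRW

/-!
# Crux `WindowedShellChannels` (stmt-FinalStateConjecture-14085), line `SketchIdeator3` — stub `stub_recentre`

Reduction to the centred tortoise line `xc = 0`, `r = tortoiseRadius hM 0` by translation.

A tortoise radius function `r` with the photon sphere at `xc` satisfies
`tortoiseRadius hM 0 y = r (y + xc)` (`IsTortoiseRadius.comp_sub_add` + `IsTortoiseRadius.unique`),
so the line potential along `tortoiseRadius hM 0` is the spatial translate `y ↦ V (y + xc)` of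
`V = linePotential M s ℓ r`.  For a general potential `V` and shift `c` (sub-namespace
`Recentre`): the spatial translate `ψ_c(t, y) := ψ(t, y + c)` of a global `C²` solution for `V`
is a global `C²` solution for `V(· + c)` (`iteratedDeriv_comp_add_const`), its energy density is
the translated one (`deriv_comp_add_const`), hence — Lebesgue measure being translation
invariant — it has the same total energy and
`exteriorEnergy V(· + c) xc a ψ_c t = exteriorEnergy V (xc + c) a ψ t`, so the same channel
energies about the translated centre; Cauchy data supported off `{|x − xc| ≤ ρ}` become data
supported off `{|y| ≤ ρ}`.  No definitions: the translate is the literal lambda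
`fun t y => ψ t (y + c)`.
-/

noncomputable section

set_option linter.dupNamespace false

namespace Summit.FinalStateConjecture.FinalStateConjecture.Theorems.WindowedShellChannelsStubs

open Literature.Geometry.Lorentzian Literature.Geometry.Lorentzian.ReggeWheeler
open Summit.FinalStateConjecture.FinalStateConjecture.Theses.PhotonSphereChannels
open Filter Set MeasureTheory
open scoped ENNReal Topology

namespace Recentre

variable {V : ℝ → ℝ} {ψ : ℝ → ℝ → ℝ}

/-- Spatial translates `ψ(·, · + c)` of a global `C²` solution for the potential `V` are global
`C²` solutions for the translated potential `V(· + c)`. -/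
theorem isSolution_xshift (hψ : IsSolution V ψ) (c : ℝ) :
    IsSolution (fun y => V (y + c)) (fun t y => ψ t (y + c)) := by
  refine ⟨hψ.1.comp (contDiff_fst.prodMk (contDiff_snd.add contDiff_const)), fun z => ?_⟩
  have h := hψ.2 (z.1, z.2 + c)
  have h1 : iteratedDeriv 2 (fun y => ψ z.1 (y + c)) z.2 = iteratedDeriv 2 (ψ z.1) (z.2 + c) := by
    rw [iteratedDeriv_comp_add_const 2 (ψ z.1) c]
  unfold IsSolutionAt at h ⊢
  simp only at h ⊢
  rw [h1]
  exact h

/-- The energy density of the spatial translate is the translated energy density. -/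
theorem energyDensity_xshift (V : ℝ → ℝ) (ψ : ℝ → ℝ → ℝ) (c t y : ℝ) :
    energyDensity (fun y => V (y + c)) (fun t y => ψ t (y + c)) t y
      = energyDensity V ψ t (y + c) := by
  unfold energyDensity
  rw [deriv_comp_add_const (ψ t) c y]

/-- The total energy is invariant under spatial translation. -/
theorem totalEnergy_xshift (V : ℝ → ℝ) (ψ : ℝ → ℝ → ℝ) (c t : ℝ) :
    totalEnergy (fun y => V (y + c)) (fun t y => ψ t (y + c)) t = totalEnergy V ψ t := by
  unfold totalEnergy
  simp only [energyDensity_xshift]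
  exact (measurePreserving_add_right volume c).lintegral_comp_emb (measurableEmbedding_addRight c)
    (fun x => ENNReal.ofReal (energyDensity V ψ t x))

/-- Exterior energies of the spatial translate about `xc` are the exterior energies of `ψ` about
the translated centre `xc + c`. -/
theorem exteriorEnergy_xshift (V : ℝ → ℝ) (ψ : ℝ → ℝ → ℝ) (c xc a t : ℝ) :
    exteriorEnergy (fun y => V (y + c)) xc a (fun t y => ψ t (y + c)) t
      = exteriorEnergy V (xc + c) a ψ t := by
  unfold exteriorEnergy
  simp only [energyDensity_xshift]
  have hset : {y : ℝ | a + |t| < |y - xc|}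
      = (fun y : ℝ => y + c) ⁻¹' {x : ℝ | a + |t| < |x - (xc + c)|} := by
    ext y
    simp only [mem_setOf_eq, mem_preimage]
    rw [show y + c - (xc + c) = y - xc by ring]
  rw [hset]
  exact (measurePreserving_add_right volume c).setLIntegral_comp_preimage_emb
    (measurableEmbedding_addRight c) (fun x => ENNReal.ofReal (energyDensity V ψ t x))
    {x : ℝ | a + |t| < |x - (xc + c)|}

/-- Channel energies of the spatial translate about `xc` are the channel energies of `ψ` about
the translated centre `xc + c`. -/
theorem channelEnergy_xshift (V : ℝ → ℝ) (ψ : ℝ → ℝ → ℝ) (c xc a : ℝ)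
    (l : Filter ℝ) :
    channelEnergy (fun y => V (y + c)) xc a (fun t y => ψ t (y + c)) l
      = channelEnergy V (xc + c) a ψ l := by
  unfold channelEnergy
  congr 1
  funext t
  exact exteriorEnergy_xshift V ψ c xc a t

/-- Cauchy data supported off the shell `{|x − xc| ≤ ρ}` translate to Cauchy data supported off
`{|y| ≤ ρ}`. -/
theorem supported_xshift {ρ xc : ℝ}
    (hsupp : CauchyDataSupportedOn ψ {x : ℝ | ρ < |x - xc|}) :
    CauchyDataSupportedOn (fun t y => ψ t (y + xc)) {y : ℝ | ρ < |y|} := by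
  intro y hy
  have hx : y + xc ∉ {x : ℝ | ρ < |x - xc|} := by simpa using hy
  exact hsupp (y + xc) hx

/-- Recentring the radius function: a tortoise radius function with the photon sphere at `xc` is
the translate of the explicit one centred at `0`, `tortoiseRadius hM 0 y = r (y + xc)`. -/
theorem tortoiseRadius_zero_eq {M : ℝ} {r : ℝ → ℝ} {xc : ℝ} (hr : IsTortoiseRadius M r xc)
    (hM : 0 < M) : tortoiseRadius hM 0 = fun y => r (y + xc) := by
  have h1 := hr.comp_sub_add 0
  simp only [sub_zero] at h1
  exact (isTortoiseRadius_tortoiseRadius hM 0).unique h1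

/-- Hence the line potential along `tortoiseRadius hM 0` is the spatial translate of the line
potential along `r`. -/
theorem linePotential_tortoiseRadius_zero_eq {M : ℝ} {r : ℝ → ℝ} {xc : ℝ}
    (hr : IsTortoiseRadius M r xc) (hM : 0 < M) (s ℓ : ℕ) :
    linePotential M s ℓ (tortoiseRadius hM 0) = fun y => linePotential M s ℓ r (y + xc) := by
  funext y
  simp only [linePotential_apply, tortoiseRadius_zero_eq hr hM]

end Recentre

/-- REDUCTION (recentring): a tortoise radius function with photon sphere at `xc` is `tortoiseRadius hM 0 (· − xc)`
(`IsTortoiseRadius.eq_tortoiseRadius`, `comp_sub_add`, `unique`); `ψ₀(t, y) := ψ(t, y + xc)` is a solution along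
`tortoiseRadius hM 0` with the same parity, data supported off `{|y| ≤ ρ}`, the same energies (translation invariance of
Lebesgue measure) and `exteriorEnergy … 0 a ψ₀ t = exteriorEnergy … xc a ψ t`. -/
theorem stub_recentre (σ : ℝ)
    (H : ∀ (M : ℝ) (hM : 0 < M), ∀ ρ : ℝ, 0 < ρ → ∃ h : ℝ, 0 ≤ h ∧ ∃ c : ℝ, 0 < c ∧
        ∀ (s ℓ : ℕ), s ≤ 2 → s ≤ ℓ → ∀ ψ : ℝ → ℝ → ℝ,
          IsRWSolution M s ℓ (tortoiseRadius hM 0) ψ → (∀ t x, ψ (-t) x = σ * ψ t x) →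
          CauchyDataSupportedOn ψ {x : ℝ | ρ < |x|} →
          totalEnergy (linePotential M s ℓ (tortoiseRadius hM 0)) ψ 0 ≠ ⊤ →
            ENNReal.ofReal c * totalEnergy (linePotential M s ℓ (tortoiseRadius hM 0)) ψ 0 ≤
              channelEnergy (linePotential M s ℓ (tortoiseRadius hM 0)) 0 (ρ - h) ψ atTop) :
    ∀ M : ℝ, 0 < M → ∀ ρ : ℝ, 0 < ρ → ∃ h : ℝ, 0 ≤ h ∧ ∃ c : ℝ, 0 < c ∧ ∀ (r : ℝ → ℝ) (xc : ℝ),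
      IsTortoiseRadius M r xc → ∀ (s ℓ : ℕ), s ≤ 2 → s ≤ ℓ → ∀ ψ : ℝ → ℝ → ℝ,
        IsRWSolution M s ℓ r ψ → (∀ t x, ψ (-t) x = σ * ψ t x) →
        CauchyDataSupportedOn ψ {x : ℝ | ρ < |x - xc|} →
        totalEnergy (linePotential M s ℓ r) ψ 0 ≠ ⊤ →
          ENNReal.ofReal c * totalEnergy (linePotential M s ℓ r) ψ 0 ≤
            channelEnergy (linePotential M s ℓ r) xc (ρ - h) ψ atTop := by
  intro M hM ρ hρ
  obtain ⟨h, hh, c, hc, H'⟩ := H M hM ρ hρ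
  refine ⟨h, hh, c, hc, fun r xc hr s ℓ hs hsℓ ψ hψ hpar hsupp hE => ?_⟩
  have hV := Recentre.linePotential_tortoiseRadius_zero_eq hr hM s ℓ
  have hsol : IsRWSolution M s ℓ (tortoiseRadius hM 0) (fun t y => ψ t (y + xc)) := by
    show IsSolution (linePotential M s ℓ (tortoiseRadius hM 0)) (fun t y => ψ t (y + xc))
    rw [hV]
    exact Recentre.isSolution_xshift hψ xc
  have hpar' : ∀ t y, (fun t y => ψ t (y + xc)) (-t) y = σ * (fun t y => ψ t (y + xc)) t y :=
    fun t y => hpar t (y + xc)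
  have hE' : totalEnergy (linePotential M s ℓ (tortoiseRadius hM 0))
      (fun t y => ψ t (y + xc)) 0 ≠ ⊤ := by
    rw [hV, Recentre.totalEnergy_xshift]
    exact hE
  have K :=
    H' s ℓ hs hsℓ (fun t y => ψ t (y + xc)) hsol hpar' (Recentre.supported_xshift hsupp) hE'
  rw [hV, Recentre.totalEnergy_xshift, Recentre.channelEnergy_xshift, zero_add] at K
  exact K

end Summit.FinalStateConjecture.FinalStateConjecture.Theorems.WindowedShellChannelsStubs

end
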